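import Summits.CriticalPhenomena.PercolationContinuityZ3.Theorems.PercNearOneGluingNoHeavyRsw3AnnulusTwoArmCritical
import HarnessLib

/-!
# RSW3 lane (P2, gen 10): "FEW ARMS ⇒ PERCOLATION" — a same-`p` criterion: if at ONE scale `N ≥ 10` the aspect-2 two-arm probability is
# small compared with the square of the easy-crossing probability, then `θ(p) > 0`

builds on p205010 (kernel theorem, internal audit signed; external expert review pending)

Cell `prim-rsw3`, prover seat `prim-rsw3-p2` (gen 10), memo `run/shared/lean/prim/rsw3/P2-RSWLITE.md` §16.
Support file (`--supports stmt-CriticalPhenomena-4575`); no definitions, no named facts, no sorries.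

`theta_pos_of_annulusTwoArmProb_lt` (EVERY `p`, every `N ≥ 10`; `η = δ^{441}/2`, `δ = 1/(2·((20+1)²+2)·(2·(3²+1)²)^{(20+1)²})`,
`σ₂ = P_p(boxCross (easyShape 2 N) 0)`, `α₂ = annulusTwoArmProb 3 p N (2N) = P_p((uniqZone N (2N))ᶜ)`):

  `α₂ < η`  and  `α₂ < σ₂² · η^{100}`   ⟹   `θ(p) > 0`.

This is the general-`p` form of the argument behind `annulusTwoArmLowerBound` (which is its contrapositive at `p = p_c`, where `θ = 0` and
`σ₂ ≥ c_E`): the sponge dichotomy `σ₂² · P((boxCross (easyShape 2 (2N)) 0)ᶜ) ≤ α₂` (p235401) turns "few arms" into a near-certain sponge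
crossing, the square-root trick localises it (`real_compl_cross_le_rpow`), and near-certain localised crossings glued by the near-certain
uniqueness zone percolate (`theta_pos_of_src_uniqZone_criterion`).  A finite-size criterion for supercriticality on `ℤ³` whose inputs are two
probabilities at one scale; thresholds explicit and astronomically small.  Corollary `annulusTwoArmProb_ge_of_le_criticalProb`: for `p ≤ p_c(ℤ³)`
and `N ≥ 10`, `α₂ ≥ min(η, σ₂²·η^{100})` — at `p < p_c` both sides are small, at `p = p_c` it is `annulusTwoArmLowerBound` for `N ≥ 10`.

References: M. Aizenman, Nucl. Phys. B 485 (1997), §2 (criterion (ii), Remark 1) [Aizenman1997]; S. Martineau, V. Tassion, Ann. Probab. 45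
(2017), §3 [MartineauTassion2017]; G. Grimmett, *Percolation* (1999), §7.4 [GrimmettPercolation1999]. [folklore]
-/

noncomputable section

namespace Summit.CriticalPhenomena.PercolationContinuityZ3.Theorems.Rsw3

open MeasureTheory Literature.Probability.LatticeModels Literature.Probability.Percolation
open Literature.Probability.Percolation.KestenZhang Literature.Probability.Percolation.KozmaNitzan SimpleGraph Relation
open Summit.CriticalPhenomena.PercolationContinuityZ3.Theorems.Crossing SurfaceTension

/-- **Few arms ⇒ percolation** (bond percolation on `ℤ³`, ANY `p`, any `N ≥ 10`): with `δ = 1/(2·((20+1)²+2)·(2·(3²+1)²)^{(20+1)²})`,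
`η = δ^{(20+1)²}/2`, if `annulusTwoArmProb 3 p N (2N) < η` and `annulusTwoArmProb 3 p N (2N) < P_p(boxCross (easyShape 2 N) 0)² · η^{100}`,
then `θ(p) > 0`.  (Sponge dichotomy ⇒ `P((boxCross (easyShape 2 (2N)) 0)ᶜ) < η^{100}`; square-root trick ⇒ localised crossing fails w.p. `≤ η`;
uniqueness zone fails w.p. `< η`; renormalisation.) [cite: Aizenman1997, §2 criterion (ii)] [cite: MartineauTassion2017, §3.3] -/
theorem theta_pos_of_annulusTwoArmProb_lt (p : unitInterval) {N : ℕ} (hN : 10 ≤ N)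
    (h₁ : annulusTwoArmProb 3 p N (2 * N) <
      (1 / (2 * ((20 + 1) ^ 2 + 2 : ℝ) * (2 * (3 ^ 2 + 1 : ℝ) ^ 2) ^ ((20 + 1) ^ 2))) ^ ((20 + 1) ^ 2) / 2)
    (h₂ : annulusTwoArmProb 3 p N (2 * N) <
      (bondPercolation (zdGraph 3) p).real (boxCross (easyShape 2 N) 0) ^ 2 *
        ((1 / (2 * ((20 + 1) ^ 2 + 2 : ℝ) * (2 * (3 ^ 2 + 1 : ℝ) ^ 2) ^ ((20 + 1) ^ 2))) ^ ((20 + 1) ^ 2) / 2) ^ 100) :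
    0 < theta (zdGraph 3) (0 : Site 3) p := by
  classical
  set μ := bondPercolation (zdGraph 3) p with hμ
  set δ : ℝ := 1 / (2 * ((20 + 1) ^ 2 + 2 : ℝ) * (2 * (3 ^ 2 + 1 : ℝ) ^ 2) ^ ((20 + 1) ^ 2)) with hδ
  set η : ℝ := δ ^ ((20 + 1) ^ 2) / 2 with hη
  have hδpos : 0 < δ := by rw [hδ]; positivity
  have hηpos : 0 < η := by rw [hη]; positivity
  set m : ℕ := (N - 1) / 2 with hm
  have hm1 : 2 * m + 1 ≤ N := by omega
  have hm2 : N ≤ 2 * m + 2 := by omega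
  -- (1) sponge dichotomy: `P((easyShape 2 (2N) block)ᶜ) ≤ η^100`
  have hdich := sq_mul_real_compl_boxCross_le_annulusTwoArmProb p (n := N) (by omega)
  rw [← hμ] at hdich
  have hblock : μ.real (boxCross (easyShape 2 (2 * N)) 0)ᶜ ≤ η ^ 100 := by
    by_contra hgt
    push Not at hgt
    have hσpos : 0 < μ.real (boxCross (easyShape 2 N) 0) ^ 2 := by
      rcases (sq_nonneg (μ.real (boxCross (easyShape 2 N) 0))).lt_or_eq with h | h
      · exact h
      · exfalso
        rw [← h, zero_mul] at h₂
        exact (not_lt.2 measureReal_nonneg) h₂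
    have : μ.real (boxCross (easyShape 2 N) 0) ^ 2 * η ^ 100 <
        μ.real (boxCross (easyShape 2 N) 0) ^ 2 * μ.real (boxCross (easyShape 2 (2 * N)) 0)ᶜ :=
      mul_lt_mul_of_pos_left hgt hσpos
    exact lt_irrefl _ ((this.trans_le hdich).trans h₂)
  -- (2) square-root trick: `P(E₀ᶜ) ≤ (η^100)^{1/100} = η`
  have hcross := real_compl_cross_le_rpow p hN
  rw [← hm, ← hμ] at hcross
  have hrpow : (μ.real (boxCross (easyShape 2 (2 * N)) 0)ᶜ) ^ (((10 : ℝ) ^ 2)⁻¹) ≤ η := by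
    have e1 : (μ.real (boxCross (easyShape 2 (2 * N)) 0)ᶜ) ^ (((10 : ℝ) ^ 2)⁻¹) ≤ (η ^ 100) ^ (((10 : ℝ) ^ 2)⁻¹) :=
      Real.rpow_le_rpow measureReal_nonneg hblock (by positivity)
    have e2 : (η ^ 100) ^ (((10 : ℝ) ^ 2)⁻¹) = η := by
      rw [show ((10 : ℝ) ^ 2)⁻¹ = ((100 : ℕ) : ℝ)⁻¹ by norm_num]
      exact Real.pow_rpow_inv_natCast hηpos.le (by norm_num)
    exact e1.trans e2.le
  -- (3) the criterion
  have hU : μ.real (uniqZone (d := 3) N (2 * N))ᶜ < η := h₁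
  have hsum : μ.real
        (linked
          (↑(Finset.Icc (![(0 : ℤ), -(9 * (m : ℤ)), -(9 * (m : ℤ))] : Site 3) ![2 * (N : ℤ), 10 * (m : ℤ), 10 * (m : ℤ)]))
          (↑(Finset.Icc (0 : Site 3) ![((0 : ℕ) : ℤ), m, m]))
          (↑(Finset.Icc (![2 * (N : ℤ), -(9 * (m : ℤ)), -(9 * (m : ℤ))] : Site 3)
            ![2 * (N : ℤ), 10 * (m : ℤ), 10 * (m : ℤ)])))ᶜ +
        μ.real (uniqZone (d := 3) N (2 * N))ᶜ ≤ δ ^ ((20 + 1) ^ 2) := by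
    have : η + η = δ ^ ((20 + 1) ^ 2) := by rw [hη]; exact add_halves _
    exact (add_le_add (hcross.trans hrpow) hU.le).trans this.le
  exact theta_pos_of_src_uniqZone_criterion p hm1 hm2 hsum

/-- **At or below `p_c(ℤ³)`, at every scale `N ≥ 10`:** `annulusTwoArmProb 3 p N (2N) ≥ min(η, P_p(boxCross (easyShape 2 N) 0)² · η^{100})`
(contrapositive of `theta_pos_of_annulusTwoArmProb_lt`, since `θ(p) ≤ θ(p_c) = 0`, p205010).  At `p = p_c` this is `annulusTwoArmLowerBound`
for `N ≥ 10` (with `σ₂ ≥ c_E`); below `p_c` both sides are small.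
builds on p205010 (kernel theorem, internal audit signed; external expert review pending). [cite: Aizenman1997, §2 Remark 1 and criterion (ii)] -/
theorem annulusTwoArmProb_ge_of_le_criticalProb (p : unitInterval) (hp : p ≤ criticalProbI 3) {N : ℕ} (hN : 10 ≤ N) :
    min ((1 / (2 * ((20 + 1) ^ 2 + 2 : ℝ) * (2 * (3 ^ 2 + 1 : ℝ) ^ 2) ^ ((20 + 1) ^ 2))) ^ ((20 + 1) ^ 2) / 2)
        ((bondPercolation (zdGraph 3) p).real (boxCross (easyShape 2 N) 0) ^ 2 *
          ((1 / (2 * ((20 + 1) ^ 2 + 2 : ℝ) * (2 * (3 ^ 2 + 1 : ℝ) ^ 2) ^ ((20 + 1) ^ 2))) ^ ((20 + 1) ^ 2) / 2) ^ 100) ≤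
      annulusTwoArmProb 3 p N (2 * N) := by
  by_contra hlt
  push Not at hlt
  have hθ : 0 < theta (zdGraph 3) (0 : Site 3) p :=
    theta_pos_of_annulusTwoArmProb_lt p hN (lt_of_lt_of_le hlt (min_le_left _ _)) (lt_of_lt_of_le hlt (min_le_right _ _))
  have h0 : theta (zdGraph 3) (0 : Site 3) (criticalProbI 3) = 0 := CSH.percolationContinuity_allDimensions 3 (by norm_num)
  have hmono : theta (zdGraph 3) (0 : Site 3) p ≤ theta (zdGraph 3) (0 : Site 3) (criticalProbI 3) :=
    theta_mono_holds (zdGraph 3) (0 : Site 3) hp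
  linarith

end Summit.CriticalPhenomena.PercolationContinuityZ3.Theorems.Rsw3

end
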